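import Summits.HodgeConjecture.HodgeConjecture.Theorems.VHCAbelianSchemesRoadIsogenyDerivedAdjointPairDefs
import Literature.AlgebraicGeometry.Modules.VectorBundleFiniteLocallyFree
import Mathlib.CategoryTheory.Linear.Basic
import HarnessLib

/-!
# Road №4 (`VHCAbelianSchemesRoad`) — the node «`IsogenyDerivedAdjointPair A g`» IS INHABITED IN DEGREE ONE: the identity isogeny
# (costume check of the node of record, crux stmt-HodgeConjecture-26512)

research route conditional on HC_CM; not a corollary; Q11.4-sentence-2 already refuted in dim ≥ 3.

Seat core-w4 (director-hodge g16 R16.13 (1): node of record = `IsogenyDerivedAdjointPair`, p648759). `--supports stmt-HodgeConjecture-26512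
--as helper`; closes NO stub or item; nothing here says the node is inhabited for an isogeny of degree `≥ 2`, nor (c1), T′, HC_CM or HC;
HC_CM HELD. PURPOSE: the node's three laws (`adj_counitClass`, `adj_comp`, `adj_mk₀_comp`) fix composition ORDERS and SHIFT CONVENTIONS
(`ShiftedHom.comp`, `shiftFunctorAdd'`, `shiftFunctorZero'`, Mathlib's sheaf counit); a mis-oriented law would be unprovable for the
route-K builders (seats core-w5 ∕ core-w7). This file certifies the shape by INHABITING the node for every endomorphism `g` whose
underlying scheme map is `𝟙` (in particular `g = 𝟙_A`) with the obvious hom-equivalence — conjugation by `g^*• ≅ 𝟭` and `g_*• ≅ 𝟭`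
(Mathlib `Scheme.Modules.pullbackCongr ∕ pullbackId ∕ pushforwardCongr ∕ pushforwardId` termwise) — the one non-formal input being Mathlib's
mate identity `conjugateEquiv_pullbackId_hom` (the counit of `pullbackPushforwardAdjunction (𝟙 X)` is `(𝟙)^*(pushforwardId) ≫ pullbackId`).
Generic in the `HasDerivedCategory` instance.

## Contents (all PROVED, 0 sorry)
* §1 `pullback_map_pushforwardId_inv_comp_counit`, `counit_app_id_eq` (`ε_M = (𝟙_X)^*(pushforwardId_M) ≫ pullbackId_M`),
  `pushforwardCongr_rfl_hom_app`, `counit_app_eq_of_eq_id` (the same for any `f = 𝟙_X`, through `pullbackCongr ∕ pushforwardCongr`).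
* §2 `pullbackComplexIsoOfEqId' ∕ pushforwardComplexIsoOfEqId' : g^*•K ≅ K, g_*•K ≅ K` for `Hom.toSchemeHom g = 𝟙` (+ naturality),
  `counitComplex_eq_of_eq_id` (`ε• = g^*•(j) ≫ ι`), `inv_comp_inv_comp_counitComplex`, `inv_comp_counitComplex_comp_inv`.
* §3 `adjOfEqId` (`z ↦ Q(ι_K⁻¹) ≫ z ≫ (Q(j_L⁻¹))⟦n⟧'`, `Linear.homCongr`) with the three laws `adjOfEqId_counitClass ∕ _comp ∕ _mk₀_comp`
  PROVED, **`pairOfEqId A g hg : IsogenyDerivedAdjointPair A g`**, **`identityPair A : IsogenyDerivedAdjointPair A (𝟙 A)`**,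
  `nonempty_isogenyDerivedAdjointPair_id`.

References: [cite: Hartshorne1977, II §5 p. 110 (f^* ⊣ f_*)] [cite: GortzWedhorn2023, Rem. F.190 and Prop. F.191] [cite: Weibel1994, §10.4 and §10.7].
-/

noncomputable section

-- `TopCat.Presheaf`/`Scheme.Modules` are not reducible (as in Mathlib's `AlgebraicGeometry/Modules/Sheaf.lean`).
set_option backward.isDefEq.respectTransparency false

open CategoryTheory CategoryTheory.Category CategoryTheory.Limits AlgebraicGeometry Opposite
open DerivedCategory

namespace Summit.HodgeConjecture.HodgeConjecture.Ring2.SemiregularRepresentatives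

set_option linter.dupNamespace false -- the cell's namespace repeats the summit name, as in every `Ring2*` file

open Literature.AlgebraicGeometry Literature.AlgebraicGeometry.Modules Literature.AlgebraicGeometry.Motives
open Literature.AlgebraicGeometry.Motives.AbelianVariety Literature.AlgebraicGeometry.KTheory
open Summit.Ventures.HSemireg Summit.Ventures.HSemireg.HomComplex

universe w u

/-! ## §1 The counit of `pullbackPushforwardAdjunction (𝟙 X)` through `pullbackId`, `pushforwardId` -/

section SheafLevel

variable {X : Scheme.{u}}

/-- **`(𝟙_X)^*(pushforwardId⁻¹_M) ≫ ε_M = pullbackId_M`** — Mathlib's mate identity `conjugateEquiv_pullbackId_hom`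
(`conjugateEquiv .id (pullbackPushforwardAdjunction (𝟙 X)) (pullbackId X).hom = (pushforwardId X).inv`) read through
`conjugateEquiv_counit`. [cite: Hartshorne1977, II §5 p. 110 (f^* ⊣ f_*)] -/
theorem pullback_map_pushforwardId_inv_comp_counit (M : X.Modules) :
    (Scheme.Modules.pullback (𝟙 X)).map ((Scheme.Modules.pushforwardId X).inv.app M) ≫
      (Scheme.Modules.pullbackPushforwardAdjunction (𝟙 X)).counit.app M = (Scheme.Modules.pullbackId X).hom.app M := by
  have h := conjugateEquiv_counit Adjunction.id (Scheme.Modules.pullbackPushforwardAdjunction (𝟙 X))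
    (Scheme.Modules.pullbackId X).hom M
  rw [Scheme.Modules.conjugateEquiv_pullbackId_hom] at h
  rw [h]
  simp only [Functor.id_obj, Adjunction.id_counit]
  exact Category.comp_id _

/-- **The counit of `(𝟙_X)^* ⊣ (𝟙_X)_*` is `(𝟙_X)^*(pushforwardId_M) ≫ pullbackId_M`.** [cite: Hartshorne1977, II §5 p. 110 (f^* ⊣ f_*)] -/
theorem counit_app_id_eq (M : X.Modules) :
    (Scheme.Modules.pullbackPushforwardAdjunction (𝟙 X)).counit.app M =
      (Scheme.Modules.pullback (𝟙 X)).map ((Scheme.Modules.pushforwardId X).hom.app M) ≫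
        (Scheme.Modules.pullbackId X).hom.app M := by
  rw [← pullback_map_pushforwardId_inv_comp_counit M, ← Category.assoc, ← Functor.map_comp, Iso.hom_inv_id_app,
    CategoryTheory.Functor.map_id, Category.id_comp]

/-- `pushforwardCongr rfl` is the identity on each module (its components are `M.presheaf.map (eqToHom rfl)`). [folklore] -/
theorem pushforwardCongr_rfl_hom_app (f : X ⟶ X) (M : X.Modules) :
    (Scheme.Modules.pushforwardCongr (rfl : f = f)).hom.app M = 𝟙 _ := by
  apply Scheme.Modules.hom_ext
  intro U
  rw [Scheme.Modules.pushforwardCongr_hom_app_app, eqToHom_refl]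
  erw [op_id, M.presheaf.map_id]
  rfl

/-- **The counit of `f^* ⊣ f_*` for `f = 𝟙_X`, through `pullbackCongr`, `pushforwardCongr`**:
`ε_M = f^*((pushforwardCongr hf ≪≫ pushforwardId)_M) ≫ (pullbackCongr hf ≪≫ pullbackId)_M`. [cite: Hartshorne1977, II §5 p. 110 (f^* ⊣ f_*)] -/
theorem counit_app_eq_of_eq_id (f : X ⟶ X) (hf : f = 𝟙 X) (M : X.Modules) :
    (Scheme.Modules.pullbackPushforwardAdjunction f).counit.app M =
      (Scheme.Modules.pullback f).map ((Scheme.Modules.pushforwardCongr hf ≪≫ Scheme.Modules.pushforwardId X).hom.app M) ≫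
        (Scheme.Modules.pullbackCongr hf ≪≫ Scheme.Modules.pullbackId X).hom.app M := by
  subst hf
  have h1 : (Scheme.Modules.pullbackCongr (rfl : 𝟙 X = 𝟙 X)).hom.app M = 𝟙 _ := rfl
  rw [Iso.trans_hom, Iso.trans_hom, NatTrans.comp_app, NatTrans.comp_app, h1, pushforwardCongr_rfl_hom_app, Category.id_comp,
    Category.id_comp]
  exact counit_app_id_eq M

end SheafLevel

/-! ## §2 `g^*•K ≅ K` and `g_*•K ≅ K` for `Hom.toSchemeHom g = 𝟙`; the counit complex -/

section Complexes

variable (A : AbelianVariety ℂ) (g : A ⟶ A) (hg : Hom.toSchemeHom g = 𝟙 A.X.left)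

/-- The underlying scheme map of `𝟙_A` is `𝟙` (definitional). [folklore] -/
theorem toSchemeHom_id : Hom.toSchemeHom (𝟙 A) = 𝟙 A.X.left := rfl

/-- **`g^*•K ≅ K`** for `Hom.toSchemeHom g = 𝟙` (Mathlib `pullbackCongr ≪≫ pullbackId` termwise). [cite: Hartshorne1977, II §5 p. 110] -/
def pullbackComplexIsoOfEqId' (K : CochainComplex A.X.left.Modules ℤ) : endoPullbackComplex A g K ≅ K :=
  HomologicalComplex.Hom.isoOfComponents
    (fun i => (Scheme.Modules.pullbackCongr hg ≪≫ Scheme.Modules.pullbackId A.X.left).app (K.X i)) (fun i j _ => by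
      have h := (Scheme.Modules.pullbackCongr hg ≪≫ Scheme.Modules.pullbackId A.X.left).hom.naturality (K.d i j)
      simp only [Functor.id_obj, Functor.id_map] at h
      simp only [Functor.mapHomologicalComplex_obj_d, Iso.app_hom]
      exact h.symm)

/-- **`g_*•K ≅ K`** for `Hom.toSchemeHom g = 𝟙` (Mathlib `pushforwardCongr ≪≫ pushforwardId` termwise). [cite: Hartshorne1977, II §5 p. 110] -/
def pushforwardComplexIsoOfEqId' (K : CochainComplex A.X.left.Modules ℤ) : endoPushforwardComplex A g K ≅ K :=
  HomologicalComplex.Hom.isoOfComponents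
    (fun i => (Scheme.Modules.pushforwardCongr hg ≪≫ Scheme.Modules.pushforwardId A.X.left).app (K.X i)) (fun i j _ => by
      have h := (Scheme.Modules.pushforwardCongr hg ≪≫ Scheme.Modules.pushforwardId A.X.left).hom.naturality (K.d i j)
      simp only [Functor.id_obj, Functor.id_map] at h
      simp only [Functor.mapHomologicalComplex_obj_d, Iso.app_hom]
      exact h.symm)

/-- Components of `pullbackComplexIsoOfEqId'` (definitional). [folklore] -/
@[simp]
theorem pullbackComplexIsoOfEqId'_hom_f (K : CochainComplex A.X.left.Modules ℤ) (i : ℤ) :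
    (pullbackComplexIsoOfEqId' A g hg K).hom.f i =
      (Scheme.Modules.pullbackCongr hg ≪≫ Scheme.Modules.pullbackId A.X.left).hom.app (K.X i) :=
  rfl

/-- Components of `pushforwardComplexIsoOfEqId'` (definitional). [folklore] -/
@[simp]
theorem pushforwardComplexIsoOfEqId'_hom_f (K : CochainComplex A.X.left.Modules ℤ) (i : ℤ) :
    (pushforwardComplexIsoOfEqId' A g hg K).hom.f i =
      (Scheme.Modules.pushforwardCongr hg ≪≫ Scheme.Modules.pushforwardId A.X.left).hom.app (K.X i) :=
  rfl

/-- **Naturality of `ι : g^*•K ≅ K`** in chain maps. [folklore] -/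
@[reassoc]
theorem pullbackComplexIsoOfEqId'_hom_naturality {K L : CochainComplex A.X.left.Modules ℤ} (f : K ⟶ L) :
    ((Scheme.Modules.pullback (Hom.toSchemeHom g)).mapHomologicalComplex (ComplexShape.up ℤ)).map f ≫
        (pullbackComplexIsoOfEqId' A g hg L).hom = (pullbackComplexIsoOfEqId' A g hg K).hom ≫ f := by
  refine HomologicalComplex.hom_ext _ _ (fun i => ?_)
  simp only [HomologicalComplex.comp_f, Functor.mapHomologicalComplex_map_f, pullbackComplexIsoOfEqId'_hom_f]
  have h := (Scheme.Modules.pullbackCongr hg ≪≫ Scheme.Modules.pullbackId A.X.left).hom.naturality (f.f i)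
  simp only [Functor.id_obj, Functor.id_map] at h
  exact h

/-- Naturality of `ι⁻¹`. [folklore] -/
@[reassoc]
theorem pullbackComplexIsoOfEqId'_inv_naturality {K L : CochainComplex A.X.left.Modules ℤ} (f : K ⟶ L) :
    (pullbackComplexIsoOfEqId' A g hg K).inv ≫
        ((Scheme.Modules.pullback (Hom.toSchemeHom g)).mapHomologicalComplex (ComplexShape.up ℤ)).map f =
      f ≫ (pullbackComplexIsoOfEqId' A g hg L).inv := by
  rw [Iso.inv_comp_eq, ← Category.assoc, Iso.eq_comp_inv, pullbackComplexIsoOfEqId'_hom_naturality]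

/-- **The counit complex for `Hom.toSchemeHom g = 𝟙`**: `ε•_L = g^*•(j_L) ≫ ι_L` (termwise `counit_app_eq_of_eq_id`).
[cite: Hartshorne1977, II §5 p. 110] -/
theorem counitComplex_eq_of_eq_id (L : CochainComplex A.X.left.Modules ℤ) :
    counitComplex A g L =
      ((Scheme.Modules.pullback (Hom.toSchemeHom g)).mapHomologicalComplex (ComplexShape.up ℤ)).map
          (pushforwardComplexIsoOfEqId' A g hg L).hom ≫ (pullbackComplexIsoOfEqId' A g hg L).hom := by
  refine HomologicalComplex.hom_ext _ _ (fun i => ?_)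
  rw [counitComplex_f, HomologicalComplex.comp_f, Functor.mapHomologicalComplex_map_f, pushforwardComplexIsoOfEqId'_hom_f,
    pullbackComplexIsoOfEqId'_hom_f]
  exact counit_app_eq_of_eq_id (Hom.toSchemeHom g) hg (L.X i)

/-- **`j_K⁻¹ ≫ ι_{g_*•K}⁻¹ ≫ ε•_K = 𝟙_K`** (naturality of `ι`, `counitComplex_eq_of_eq_id`). [folklore] -/
theorem inv_comp_inv_comp_counitComplex (K : CochainComplex A.X.left.Modules ℤ) :
    (pushforwardComplexIsoOfEqId' A g hg K).inv ≫ (pullbackComplexIsoOfEqId' A g hg (endoPushforwardComplex A g K)).inv ≫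
      counitComplex A g K = 𝟙 K := by
  rw [counitComplex_eq_of_eq_id A g hg, pullbackComplexIsoOfEqId'_inv_naturality_assoc, Iso.inv_hom_id, Category.comp_id,
    Iso.inv_hom_id]

/-- **`ι_{g_*•L}⁻¹ ≫ ε•_L ≫ j_L⁻¹ = 𝟙`** (the form consumed by `adj_counitClass`). [folklore] -/
theorem inv_comp_counitComplex_comp_inv (L : CochainComplex A.X.left.Modules ℤ) :
    (pullbackComplexIsoOfEqId' A g hg (endoPushforwardComplex A g L)).inv ≫ counitComplex A g L ≫
      (pushforwardComplexIsoOfEqId' A g hg L).inv = 𝟙 _ := by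
  rw [counitComplex_eq_of_eq_id A g hg, Category.assoc, pullbackComplexIsoOfEqId'_inv_naturality_assoc, Iso.inv_hom_id_assoc,
    Iso.hom_inv_id]

end Complexes

/-! ## §3 The pair for `Hom.toSchemeHom g = 𝟙`, and the identity pair -/

section Pair

variable (A : AbelianVariety ℂ) (g : A ⟶ A) (hg : Hom.toSchemeHom g = 𝟙 A.X.left) [HasDerivedCategory.{w} A.X.left.Modules]

/-- The hom-equivalence of the degree-one pair: conjugation by `Q(ι_K)` and `(Q(j_L))⁻¹⟦n⟧` (`Linear.homCongr`). [cite: GortzWedhorn2023, Prop. F.191] -/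
def adjOfEqId (K L : CochainComplex A.X.left.Modules ℤ) (n : ℤ) :
    ShiftedHom (Q.obj (endoPullbackComplex A g K)) (Q.obj L) n ≃ₗ[ℂ] ShiftedHom (Q.obj K) (Q.obj (endoPushforwardComplex A g L)) n :=
  Linear.homCongr ℂ (Q.mapIso (pullbackComplexIsoOfEqId' A g hg K))
    ((shiftFunctor (DerivedCategory A.X.left.Modules) n).mapIso (Q.mapIso (pushforwardComplexIsoOfEqId' A g hg L).symm))

/-- `adjOfEqId` unfolded: `z ↦ Q(ι_K⁻¹) ≫ z ≫ (Q(j_L⁻¹))⟦n⟧'`. [folklore] -/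
theorem adjOfEqId_apply (K L : CochainComplex A.X.left.Modules ℤ) (n : ℤ)
    (z : ShiftedHom (Q.obj (endoPullbackComplex A g K)) (Q.obj L) n) :
    adjOfEqId A g hg K L n z = Q.map (pullbackComplexIsoOfEqId' A g hg K).inv ≫ z ≫
      (Q.map (pushforwardComplexIsoOfEqId' A g hg L).inv)⟦n⟧' := by
  change Linear.homCongr ℂ _ _ z = _
  rw [Linear.homCongr_apply]
  simp only [Functor.mapIso_inv, Functor.mapIso_hom, Iso.symm_hom, Category.assoc]

/-- Law `adj_counitClass` for the degree-one pair: `ι⁻¹ ≫ ε• ≫ j⁻¹ = 𝟙` and naturality of `shiftFunctorZero'`. [folklore] -/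
theorem adjOfEqId_counitClass (L : CochainComplex A.X.left.Modules ℤ) :
    adjOfEqId A g hg (endoPushforwardComplex A g L) L 0 (counitClass A g L) = ShiftedHom.mk₀ (0 : ℤ) rfl (𝟙 _) := by
  rw [adjOfEqId_apply, counitClass_def, ShiftedHom.mk₀, ShiftedHom.mk₀, Category.id_comp, Category.assoc]
  have hz := (shiftFunctorZero' (DerivedCategory A.X.left.Modules) (0 : ℤ) rfl).inv.naturality
    (Q.map (pushforwardComplexIsoOfEqId' A g hg L).inv)
  simp only [Functor.id_map, Functor.id_obj] at hz
  rw [← hz, ← Q.map_comp_assoc, ← Q.map_comp_assoc]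
  simp only [Category.assoc]
  rw [inv_comp_counitComplex_comp_inv A g hg, CategoryTheory.Functor.map_id, Category.id_comp]

/-- Law `adj_comp` for the degree-one pair: `j⁻¹ ≫ ι⁻¹ ≫ ε• = 𝟙` and naturality of `shiftFunctorAdd'`. [folklore] -/
theorem adjOfEqId_comp {K' K L : CochainComplex A.X.left.Modules ℤ} {a b c : ℤ}
    (z : ShiftedHom (Q.obj (endoPullbackComplex A g K')) (Q.obj K) a) (y : ShiftedHom (Q.obj K) (Q.obj L) b) (h : b + a = c) :
    adjOfEqId A g hg K' L c (z.comp y h) =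
      (adjOfEqId A g hg K' K a z).comp (adjOfEqId A g hg (endoPushforwardComplex A g K) L b
        ((counitClass A g K).comp y (add_zero b))) h := by
  rw [counitClass_def, ShiftedHom.mk₀_comp]
  simp only [adjOfEqId_apply, ShiftedHom.comp, Functor.map_comp, Category.assoc]
  have key : ∀ {Z : DerivedCategory A.X.left.Modules} (φ : _ ⟶ Z),
      (Q.map (pushforwardComplexIsoOfEqId' A g hg K).inv)⟦a⟧' ≫
        (Q.map (pullbackComplexIsoOfEqId' A g hg (endoPushforwardComplex A g K)).inv)⟦a⟧' ≫
          (Q.map (counitComplex A g K))⟦a⟧' ≫ φ = φ := by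
    intro Z φ
    rw [← Functor.map_comp_assoc, ← Functor.map_comp_assoc, ← Q.map_comp, ← Q.map_comp, Category.assoc,
      inv_comp_inv_comp_counitComplex A g hg, CategoryTheory.Functor.map_id, CategoryTheory.Functor.map_id, Category.id_comp]
  have hnat := (shiftFunctorAdd' (DerivedCategory A.X.left.Modules) b a c h).inv.naturality
    (Q.map (pushforwardComplexIsoOfEqId' A g hg L).inv)
  simp only [Functor.comp_map] at hnat
  rw [key, hnat]

/-- Law `adj_mk₀_comp` for the degree-one pair: naturality of `ι`. [folklore] -/
theorem adjOfEqId_mk₀_comp {K' K L : CochainComplex A.X.left.Modules ℤ} {n : ℤ} (f : K' ⟶ K)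
    (z : ShiftedHom (Q.obj (endoPullbackComplex A g K)) (Q.obj L) n) :
    adjOfEqId A g hg K' L n ((ShiftedHom.mk₀ (0 : ℤ) rfl
        (Q.map (((Scheme.Modules.pullback (Hom.toSchemeHom g)).mapHomologicalComplex (ComplexShape.up ℤ)).map f))).comp z
          (add_zero n)) =
      (ShiftedHom.mk₀ (0 : ℤ) rfl (Q.map f)).comp (adjOfEqId A g hg K L n z) (add_zero n) := by
  rw [ShiftedHom.mk₀_comp, ShiftedHom.mk₀_comp]
  simp only [adjOfEqId_apply, Category.assoc]
  rw [← Q.map_comp_assoc, pullbackComplexIsoOfEqId'_inv_naturality, Q.map_comp_assoc]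

/-- **THE NODE IS INHABITED whenever the underlying scheme map is the identity**: `pairOfEqId A g hg : IsogenyDerivedAdjointPair A g`
(`adj := adjOfEqId`, the three laws by `adjOfEqId_counitClass ∕ _comp ∕ _mk₀_comp`; `g_*•` preserves bounded vector-bundle complexes
since `g_*•K ≅ K`). [cite: GortzWedhorn2023, Rem. F.190 and Prop. F.191] [cite: Hartshorne1977, II §5 p. 110 (f^* ⊣ f_*)] -/
def pairOfEqId : IsogenyDerivedAdjointPair A g where
  isBoundedVBComplex_pushforward K hK := by
    obtain ⟨s, hs⟩ := hK.exists_finset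
    exact ⟨fun i => Literature.AlgebraicGeometry.Modules.isFiniteLocallyFree_of_iso
        ((HomologicalComplex.eval _ _ i).mapIso (pushforwardComplexIsoOfEqId' A g hg K)).symm (hK.isFiniteLocallyFree i),
      s, fun i hi => isZero_pushforward_of_isZero g (hs i hi)⟩
  adj K L _ _ n := adjOfEqId A g hg K L n
  adj_counitClass L _ := adjOfEqId_counitClass A g hg L
  adj_comp K' K L _ _ _ a b c z y h := adjOfEqId_comp A g hg z y h
  adj_mk₀_comp K' K L _ _ _ n f z := adjOfEqId_mk₀_comp A g hg f z

/-- **`identityPair A : IsogenyDerivedAdjointPair A (𝟙 A)`** — the node is inhabited in degree one. [cite: GortzWedhorn2023, Prop. F.191] -/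
def identityPair : IsogenyDerivedAdjointPair A (𝟙 A) :=
  pairOfEqId A (𝟙 A) (toSchemeHom_id A)

/-- The hom-equivalence of `identityPair` (definitional). [folklore] -/
theorem identityPair_adj {K L : CochainComplex A.X.left.Modules ℤ} (hK : IsBoundedVBComplex K) (hL : IsBoundedVBComplex L)
    (n : ℤ) : (identityPair A).adj hK hL n = adjOfEqId A (𝟙 A) (toSchemeHom_id A) K L n :=
  rfl

/-- **The node is inhabited for the identity isogeny.** [cite: GortzWedhorn2023, Prop. F.191] -/
theorem nonempty_isogenyDerivedAdjointPair_id : Nonempty (IsogenyDerivedAdjointPair A (𝟙 A)) :=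
  ⟨identityPair A⟩

end Pair

end Summit.HodgeConjecture.HodgeConjecture.Ring2.SemiregularRepresentatives

end
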